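import Mathlib
import HarnessLib
import Literature.Analysis.FluidPDE.VectorCalculus
import Literature.Analysis.FluidPDE.VorticityCalculus
import Literature.Analysis.FluidPDE.TaoEnstrophyLocalisation
import Literature.Analysis.FluidPDE.HessianLaplacian
import Literature.Analysis.FluidPDE.FirstIntegralTransportDefect
import Literature.Analysis.FluidPDE.TypeIAncientMild
import Summits.NavierStokesRegularity.NavierStokesRegularity.Theorems.PoloidalWindowDoorPoloidalWindowRigidityWindow
import Summits.NavierStokesRegularity.NavierStokesRegularity.Theorems.PoloidalWindowDoorPoloidalWindowRigidityVelocityGradientLaw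
import Summits.NavierStokesRegularity.NavierStokesRegularity.Theorems.PoloidalWindowDoorPoloidalWindowRigiditySeparatedPressure

/-!
# Route `PoloidalWindowDoor`, crux `PoloidalWindowRigidity` (K2, stmt-NavierStokesRegularity-19708) —
# LEIBNIZ CALCULUS for the scalar material operator and the rotated-gradient law with residual

Cell ns-regularity-ideate, seat ns-poloidal-K2-p3 (stub-worker, gen 2; support lemmas `--supports` the crux,
`--as helper`).  Tooling for the kernel form of K2-p1's Clebsch-slope law (★★) (K2P1-S2-NOTES §4; file
`…SlopeLaw`): the scalar material operator in the shape of the lead's L4,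
`𝓛θ(t,x) := deriv (θ · x) t + D(θ t)(x)[V] − Δ(θ t)(x)`, obeys

* `material_mul` — `𝓛(θ₁θ₂) = θ₁𝓛θ₂ + θ₂𝓛θ₁ − 2 Σᵢ ∂ᵢθ₁ ∂ᵢθ₂` (time: `deriv_fun_mul`; space: `fderiv_fun_mul`;
  Laplacian: Literature `laplacian_mul_eq`), and `material_add`;
* `fderiv_mul_coord` — the spatial Leibniz rule `∂ₖ(θ₁θ₂) = θ₁∂ₖθ₂ + θ₂∂ₖθ₁` in the same shape;

and, for a profile `v` of the route's Type-I class, the ATOMS of the slope law are admissible for this calculus: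

* `differentiableAt_curl_slice_coord`, `differentiableAt_fderiv_slice_coord` — `s ↦ ωₐ(s,x)` and `s ↦ (∂_b v)ᵢ(s,x)` are
  differentiable at every `t < 0`; `contDiff_curl_coord` (`C²`), `contDiff_fderiv_coord` (`C^∞`) — their slices are smooth;
* `rotatedGradient_equation` — the GENERAL (residual-carrying) form of
  `…SeparatedPressure.rotatedGradient_equation_of_separatedPressure`: for a profile poloidal on the slice `t`
  (`ω₂ ≡ 0`, hence `∂₀v₁ = ∂₁v₀`; `div v = 0`), the rotated horizontal gradient `Y = (−∂₁v₂, ∂₀v₂)` obeys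
  `𝓛(∂₀v₂) = −∂₁v₂·∂₀v₁ + ∂₀v₂·∂₁v₁ + (∂₀f)₂` and `𝓛(∂₁v₂) = ∂₁v₂·∂₀v₀ − ∂₀v₂·∂₁v₀ + (∂₁f)₂`, i.e.
  `𝓛Yₐ = Y₀∂₀vₐ + Y₁∂₁vₐ + Rₐ` with `R = (−(∂₁f)₂, (∂₀f)₂) = J∇_h f₂` (`f` the intrinsic residual, `= −∇p`).

WHAT THIS IS NOT: not a claim about Navier–Stokes regularity and not the open residue S2′ — calculus bookkeeping for a door
route's Type-I Liouville problem (bears_on LADDER-NS N0, rung N0-LocalTubeDoorPoloidal).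
-/

noncomputable section

-- the summit and its single sub-problem share the name (CONVENTIONS §1), as in every Theorems file
set_option linter.dupNamespace false

namespace Summit.NavierStokesRegularity.NavierStokesRegularity.Theorems.PoloidalWindowDoorPoloidalWindowRigidityMaterialLeibniz

open MeasureTheory Set Function Filter Topology TopologicalSpace Metric InnerProductSpace
open scoped RealInnerProductSpace InnerProductSpace Laplacian ContDiff
open Literature.Analysis Literature.Analysis.FluidPDE
open Summit.NavierStokesRegularity.NavierStokesRegularity.Theorems.PoloidalWindowDoorPoloidalWindowRigidityWindow
open Summit.NavierStokesRegularity.NavierStokesRegularity.Theorems.PoloidalWindowDoorPoloidalWindowRigidityVelocityGradientLaw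
open Summit.NavierStokesRegularity.NavierStokesRegularity.Theorems.PoloidalWindowDoorPoloidalWindowRigiditySeparatedPressure

variable {C : ℝ} {v : ℝ → EuclideanSpace ℝ (Fin 3) → EuclideanSpace ℝ (Fin 3)}

/-! ### Leibniz calculus for the scalar material operator -/

/-- **Leibniz rule for the scalar material operator.**  For scalars `θ₁, θ₂ : ℝ → ℝ³ → ℝ` differentiable in time
at `(t,x)` with `C²` slices at time `t`, and any vector `V`:
`𝓛(θ₁θ₂) = θ₁ 𝓛θ₂ + θ₂ 𝓛θ₁ − 2 Σᵢ ∂ᵢθ₁ ∂ᵢθ₂`, `𝓛θ := deriv (θ · x) t + D(θ t)(x)[V] − Δ(θ t)(x)`. -/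
theorem material_mul {θ₁ θ₂ : ℝ → EuclideanSpace ℝ (Fin 3) → ℝ} {t : ℝ} {x : EuclideanSpace ℝ (Fin 3)}
    (V : EuclideanSpace ℝ (Fin 3))
    (h1t : DifferentiableAt ℝ (fun s => θ₁ s x) t) (h2t : DifferentiableAt ℝ (fun s => θ₂ s x) t)
    (h1x : ContDiff ℝ 2 (θ₁ t)) (h2x : ContDiff ℝ 2 (θ₂ t)) :
    deriv (fun s => θ₁ s x * θ₂ s x) t + fderiv ℝ (fun y => θ₁ t y * θ₂ t y) x V
        - Δ (fun y => θ₁ t y * θ₂ t y) x =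
      θ₁ t x * (deriv (fun s => θ₂ s x) t + fderiv ℝ (θ₂ t) x V - Δ (θ₂ t) x)
        + θ₂ t x * (deriv (fun s => θ₁ s x) t + fderiv ℝ (θ₁ t) x V - Δ (θ₁ t) x)
        - 2 * ∑ i : Fin 3, fderiv ℝ (θ₁ t) x (EuclideanSpace.single i 1) * fderiv ℝ (θ₂ t) x (EuclideanSpace.single i 1) := by
  have hd1 : DifferentiableAt ℝ (θ₁ t) x := (h1x.differentiable (by norm_num)) x
  have hd2 : DifferentiableAt ℝ (θ₂ t) x := (h2x.differentiable (by norm_num)) x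
  rw [deriv_fun_mul h1t h2t, fderiv_fun_mul hd1 hd2,
    laplacian_mul_eq (EuclideanSpace.basisFun (Fin 3) ℝ) h1x h2x x]
  simp only [_root_.add_apply, FunLike.coe_smul, Pi.smul_apply, smul_eq_mul,
    EuclideanSpace.basisFun_apply]
  ring

/-- **Additivity of the scalar material operator** (time: `deriv_fun_add`; space: `fderiv_fun_add`; Laplacian:
`ContDiffAt.laplacian_add`). -/
theorem material_add {θ₁ θ₂ : ℝ → EuclideanSpace ℝ (Fin 3) → ℝ} {t : ℝ} {x : EuclideanSpace ℝ (Fin 3)}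
    (V : EuclideanSpace ℝ (Fin 3))
    (h1t : DifferentiableAt ℝ (fun s => θ₁ s x) t) (h2t : DifferentiableAt ℝ (fun s => θ₂ s x) t)
    (h1x : ContDiff ℝ 2 (θ₁ t)) (h2x : ContDiff ℝ 2 (θ₂ t)) :
    deriv (fun s => θ₁ s x + θ₂ s x) t + fderiv ℝ (fun y => θ₁ t y + θ₂ t y) x V
        - Δ (fun y => θ₁ t y + θ₂ t y) x =
      (deriv (fun s => θ₁ s x) t + fderiv ℝ (θ₁ t) x V - Δ (θ₁ t) x)
        + (deriv (fun s => θ₂ s x) t + fderiv ℝ (θ₂ t) x V - Δ (θ₂ t) x) := by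
  have hd1 : DifferentiableAt ℝ (θ₁ t) x := (h1x.differentiable (by norm_num)) x
  have hd2 : DifferentiableAt ℝ (θ₂ t) x := (h2x.differentiable (by norm_num)) x
  have hΔ : Δ (fun y => θ₁ t y + θ₂ t y) x = Δ (θ₁ t) x + Δ (θ₂ t) x := by
    have hfun : (fun y => θ₁ t y + θ₂ t y) = θ₁ t + θ₂ t := by funext y; rfl
    rw [hfun, (h1x.contDiffAt.of_le le_rfl).laplacian_add (h2x.contDiffAt.of_le le_rfl)]
  rw [deriv_fun_add h1t h2t, fderiv_fun_add hd1 hd2, hΔ]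
  simp only [_root_.add_apply]
  ring

/-- Spatial Leibniz rule in coordinates: `∂ₖ(θ₁θ₂) = θ₁ ∂ₖθ₂ + θ₂ ∂ₖθ₁`. -/
theorem fderiv_mul_coord {g₁ g₂ : EuclideanSpace ℝ (Fin 3) → ℝ} {x : EuclideanSpace ℝ (Fin 3)}
    (h1 : DifferentiableAt ℝ g₁ x) (h2 : DifferentiableAt ℝ g₂ x) (w : EuclideanSpace ℝ (Fin 3)) :
    fderiv ℝ (fun y => g₁ y * g₂ y) x w = g₁ x * fderiv ℝ g₂ x w + g₂ x * fderiv ℝ g₁ x w := by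
  rw [fderiv_fun_mul h1 h2]
  simp only [_root_.add_apply, FunLike.coe_smul, Pi.smul_apply, smul_eq_mul]

/-- Spatial additivity in coordinates: `∂ₖ(θ₁ + θ₂) = ∂ₖθ₁ + ∂ₖθ₂`. -/
theorem fderiv_add_coord {g₁ g₂ : EuclideanSpace ℝ (Fin 3) → ℝ} {x : EuclideanSpace ℝ (Fin 3)}
    (h1 : DifferentiableAt ℝ g₁ x) (h2 : DifferentiableAt ℝ g₂ x) (w : EuclideanSpace ℝ (Fin 3)) :
    fderiv ℝ (fun y => g₁ y + g₂ y) x w = fderiv ℝ g₁ x w + fderiv ℝ g₂ x w := by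
  rw [fderiv_fun_add h1 h2]
  simp only [_root_.add_apply]

/-! ### The atoms of the slope law are admissible (class regularity) -/

/-- The slice map `y ↦ (∂_b v)ᵢ(t,y)` of a profile of the class is `C^∞`. -/
theorem contDiff_fderiv_coord (hrate : HasTypeITimeDecay C v)
    (hcont : ContinuousOn (uncurry v) (Iio (0 : ℝ) ×ˢ univ))
    (hmild : ∀ s t : ℝ, s < t → t < 0 → ∀ x,
      v t x = UnboundedOperators.heatExtension (v s) (t - s) x - oseenDuhamel 1 s v v t x)
    (hdiv : ∀ t < 0, VectorCalculus.IsDivFree (v t)) {t : ℝ} (ht : t < 0) (b : EuclideanSpace ℝ (Fin 3))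
    (i : Fin 3) : ContDiff ℝ ∞ (fun y => fderiv ℝ (v t) y b i) := by
  have hA : IsTypeIAncientMild C v := isTypeIAncientMild_of_class hrate hcont hmild hdiv
  have hs : ContDiff ℝ ∞ (v t) := hA.contDiff_slice ht
  have h1 : ContDiff ℝ ∞ (fun y => fderiv ℝ (v t) y b) := (hs.fderiv_right (m := ∞) (by norm_cast)).clm_apply contDiff_const
  exact (EuclideanSpace.proj (𝕜 := ℝ) i : EuclideanSpace ℝ (Fin 3) →L[ℝ] ℝ).contDiff.comp h1

/-- The slice map `y ↦ ωₐ(t,y) = (curl v(t))ₐ(y)` of a profile of the class is `C²` (indeed `C^∞`; `C²` is what the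
Leibniz calculus consumes). -/
theorem contDiff_curl_coord (hrate : HasTypeITimeDecay C v)
    (hcont : ContinuousOn (uncurry v) (Iio (0 : ℝ) ×ˢ univ))
    (hmild : ∀ s t : ℝ, s < t → t < 0 → ∀ x,
      v t x = UnboundedOperators.heatExtension (v s) (t - s) x - oseenDuhamel 1 s v v t x)
    (hdiv : ∀ t < 0, VectorCalculus.IsDivFree (v t)) {t : ℝ} (ht : t < 0) (a : Fin 3) :
    ContDiff ℝ 2 (fun y => curl (v t) y a) := by
  have hA : IsTypeIAncientMild C v := isTypeIAncientMild_of_class hrate hcont hmild hdiv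
  have hv3 : ContDiff ℝ 3 (v t) := (hA.contDiff_slice ht).of_le (by norm_cast)
  have hc : ContDiff ℝ 2 (curl (v t)) := contDiff_curl (n := 2) (by exact_mod_cast hv3)
  exact (EuclideanSpace.proj (𝕜 := ℝ) a : EuclideanSpace ℝ (Fin 3) →L[ℝ] ℝ).contDiff.comp hc

/-- The time line `s ↦ Dv(s)(x)` of a profile of the class is differentiable at every `t < 0` (mixed partials). -/
theorem hasDerivAt_fderiv_slice_of_class (hrate : HasTypeITimeDecay C v)
    (hcont : ContinuousOn (uncurry v) (Iio (0 : ℝ) ×ˢ univ))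
    (hmild : ∀ s t : ℝ, s < t → t < 0 → ∀ x,
      v t x = UnboundedOperators.heatExtension (v s) (t - s) x - oseenDuhamel 1 s v v t x)
    (hdiv : ∀ t < 0, VectorCalculus.IsDivFree (v t)) {t : ℝ} (ht : t < 0) (x : EuclideanSpace ℝ (Fin 3)) :
    DifferentiableAt ℝ (fun s => fderiv ℝ (v s) x) t :=
  (hasDerivAt_fderiv_slice_of_contDiffAt
    (contDiffAt_uncurry_of_class hrate hcont hmild hdiv ht x 2)).2.differentiableAt

/-- The time line `s ↦ (∂_b v)ᵢ(s,x)` of a profile of the class is differentiable at every `t < 0`. -/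
theorem differentiableAt_fderiv_slice_coord (hrate : HasTypeITimeDecay C v)
    (hcont : ContinuousOn (uncurry v) (Iio (0 : ℝ) ×ˢ univ))
    (hmild : ∀ s t : ℝ, s < t → t < 0 → ∀ x,
      v t x = UnboundedOperators.heatExtension (v s) (t - s) x - oseenDuhamel 1 s v v t x)
    (hdiv : ∀ t < 0, VectorCalculus.IsDivFree (v t)) {t : ℝ} (ht : t < 0) (x b : EuclideanSpace ℝ (Fin 3))
    (i : Fin 3) : DifferentiableAt ℝ (fun s => fderiv ℝ (v s) x b i) t := by
  have hD := hasDerivAt_fderiv_slice_of_class hrate hcont hmild hdiv ht x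
  have h1 : DifferentiableAt ℝ (fun s => fderiv ℝ (v s) x b) t :=
    ((ContinuousLinearMap.apply ℝ (EuclideanSpace ℝ (Fin 3)) b).differentiableAt).comp t hD
  exact ((EuclideanSpace.proj (𝕜 := ℝ) i : EuclideanSpace ℝ (Fin 3) →L[ℝ] ℝ).differentiableAt).comp t h1

/-- The time line `s ↦ ωₐ(s,x)` of a profile of the class is differentiable at every `t < 0`
(`curl = curlCLM ∘ fderiv`). -/
theorem differentiableAt_curl_slice_coord (hrate : HasTypeITimeDecay C v)
    (hcont : ContinuousOn (uncurry v) (Iio (0 : ℝ) ×ˢ univ))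
    (hmild : ∀ s t : ℝ, s < t → t < 0 → ∀ x,
      v t x = UnboundedOperators.heatExtension (v s) (t - s) x - oseenDuhamel 1 s v v t x)
    (hdiv : ∀ t < 0, VectorCalculus.IsDivFree (v t)) {t : ℝ} (ht : t < 0) (x : EuclideanSpace ℝ (Fin 3))
    (a : Fin 3) : DifferentiableAt ℝ (fun s => curl (v s) x a) t := by
  have hD := hasDerivAt_fderiv_slice_of_class hrate hcont hmild hdiv ht x
  have h1 : DifferentiableAt ℝ (fun s => curl (v s) x) t := by
    have hfun : (fun s => curl (v s) x) = fun s => curlCLM (fderiv ℝ (v s) x) := by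
      funext s; exact curl_eq_curlCLM (v s) x
    rw [hfun]
    exact (curlCLM.differentiableAt).comp t hD
  exact ((EuclideanSpace.proj (𝕜 := ℝ) a : EuclideanSpace ℝ (Fin 3) →L[ℝ] ℝ).differentiableAt).comp t h1

/-! ### The rotated-gradient law with residual (general form) -/

/-- **Rotated-gradient law, general form.**  For a profile of the class, poloidal on the slice `t` (`ω₂(t,·) ≡ 0`),
at every `x`:  `𝓛(∂₀v₂) = −∂₁v₂·∂₀v₁ + ∂₀v₂·∂₁v₁ + (∂₀f)₂` and `𝓛(∂₁v₂) = ∂₁v₂·∂₀v₀ − ∂₀v₂·∂₁v₀ + (∂₁f)₂`, i.e. for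
`Y = (−∂₁v₂, ∂₀v₂)`: `𝓛Yₐ = Y₀∂₀vₐ + Y₁∂₁vₐ + Rₐ`, `R = (−(∂₁f)₂, (∂₀f)₂)` (the separated-pressure stratum is `R = 0`). -/
theorem rotatedGradient_equation (hrate : HasTypeITimeDecay C v)
    (hcont : ContinuousOn (uncurry v) (Iio (0 : ℝ) ×ˢ univ))
    (hmild : ∀ s t : ℝ, s < t → t < 0 → ∀ x,
      v t x = UnboundedOperators.heatExtension (v s) (t - s) x - oseenDuhamel 1 s v v t x)
    (hdiv : ∀ t < 0, VectorCalculus.IsDivFree (v t)) {t : ℝ} (ht : t < 0)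
    (hpol : ∀ y, ⟪curl (v t) y, EuclideanSpace.single 2 1⟫_ℝ = 0) (x : EuclideanSpace ℝ (Fin 3)) :
    (deriv (fun s => fderiv ℝ (v s) x (EuclideanSpace.single 0 1) 2) t
        + fderiv ℝ (fun y => fderiv ℝ (v t) y (EuclideanSpace.single 0 1) 2) x (v t x)
        - Δ (fun y => fderiv ℝ (v t) y (EuclideanSpace.single 0 1) 2) x =
      -fderiv ℝ (v t) x (EuclideanSpace.single 1 1) 2 * fderiv ℝ (v t) x (EuclideanSpace.single 0 1) 1 +
        fderiv ℝ (v t) x (EuclideanSpace.single 0 1) 2 * fderiv ℝ (v t) x (EuclideanSpace.single 1 1) 1 +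
        fderiv ℝ (fun y => timeDerivWithin (Iio 0) v t y + convect (v t) (v t) y - Δ (v t) y) x
          (EuclideanSpace.single 0 1) 2) ∧
    (deriv (fun s => fderiv ℝ (v s) x (EuclideanSpace.single 1 1) 2) t
        + fderiv ℝ (fun y => fderiv ℝ (v t) y (EuclideanSpace.single 1 1) 2) x (v t x)
        - Δ (fun y => fderiv ℝ (v t) y (EuclideanSpace.single 1 1) 2) x =
      fderiv ℝ (v t) x (EuclideanSpace.single 1 1) 2 * fderiv ℝ (v t) x (EuclideanSpace.single 0 1) 0 -
        fderiv ℝ (v t) x (EuclideanSpace.single 0 1) 2 * fderiv ℝ (v t) x (EuclideanSpace.single 1 1) 0 +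
        fderiv ℝ (fun y => timeDerivWithin (Iio 0) v t y + convect (v t) (v t) y - Δ (v t) y) x
          (EuclideanSpace.single 1 1) 2) := by
  -- poloidal: `∂₀v₁ = ∂₁v₀`
  have hω2 : curl (v t) x 2 = 0 := by simpa [EuclideanSpace.inner_single_right] using hpol x
  have hsym : fderiv ℝ (v t) x (EuclideanSpace.single 0 1) 1 = fderiv ℝ (v t) x (EuclideanSpace.single 1 1) 0 := by
    have h : fderiv ℝ (v t) x (EuclideanSpace.single 0 1) 1 - fderiv ℝ (v t) x (EuclideanSpace.single 1 1) 0 = 0 := by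
      simpa [curl] using hω2
    linarith
  -- div-free: `∂₀v₀ + ∂₁v₁ + ∂₂v₂ = 0`
  have hdv : fderiv ℝ (v t) x (EuclideanSpace.single 0 1) 0 + fderiv ℝ (v t) x (EuclideanSpace.single 1 1) 1 +
      fderiv ℝ (v t) x (EuclideanSpace.single 2 1) 2 = 0 := by
    have hd := hdiv t ht x
    rw [divergence_eq_sum_inner_fderiv (EuclideanSpace.basisFun (Fin 3) ℝ)] at hd
    simpa only [Fin.sum_univ_three, EuclideanSpace.basisFun_apply, EuclideanSpace.inner_single_left,
      map_one, one_mul] using hd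
  have h22 : fderiv ℝ (v t) x (EuclideanSpace.single 2 1) 2 =
      -(fderiv ℝ (v t) x (EuclideanSpace.single 0 1) 0 + fderiv ℝ (v t) x (EuclideanSpace.single 1 1) 1) := by
    linarith
  refine ⟨?_, ?_⟩
  · rw [verticalGradient_equation hrate hcont hmild hdiv ht x (EuclideanSpace.single 0 1)]
    simp only [Fin.sum_univ_three]
    rw [h22, hsym]
    ring
  · rw [verticalGradient_equation hrate hcont hmild hdiv ht x (EuclideanSpace.single 1 1)]
    simp only [Fin.sum_univ_three]
    rw [h22, ← hsym]
    ring

end Summit.NavierStokesRegularity.NavierStokesRegularity.Theorems.PoloidalWindowDoorPoloidalWindowRigidityMaterialLeibniz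

end
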